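import Literature.Analysis.InnerProduct.HexagonalTorusHeatTraceExpansion
import Literature.Analysis.InnerProduct.IsoscelesRightTriangleHeatTraceExpansion
import HarnessLib

/-!
# LAMÉ'S EQUILATERAL TRIANGLE: Dirichlet spectrum `{(16π²/(9ℓ²))(m² + mn + n²) : m, n ≥ 1}` (Bérard, Bérard–Helffer),
# `Z_T = (Θ_hex − 3θ + 2)/6` by the Weyl group of `A₂`, hence `Z_T(t) = |T|/(4πt) − |∂T|/(8√(πt)) + 1/3 + O(t^∞)` —
# KAC'S CORNER TERM `3·(π² − (π/3)²)/(24π·π/3) = 1/3`; Weyl, `ζ_T(0) = 1/3`, and one can hear that a triangular drum is equilateral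
# (among rectangles and isosceles right triangles)

Layer `Literature/Analysis/InnerProduct`, namespace `Literature.Analysis.InnerProduct`; sequel to the hexagonal torus (row g39-#5
`HexagonalTorusHeatTraceExpansion.lean`, IMPORTED: `summable_exp_neg_mul_hexagonalTorus`, `isBigO_hexagonalTorus_heatTrace_sub` —
the equilateral torus `Θ_hex`), the Dirichlet interval / rectangle (row g38-#2: `summable_exp_neg_mul_dirichletInterval`,
`tsum_exp_neg_mul_dirichletInterval_eq`, `summable_exp_neg_mul_dirichletRectangle`, `tendsto_dirichletRectangle_cofinite_atTop`,
`isBigO_dirichletRectangle_heatTrace_expansion`, the scaled circle `summable_exp_neg_mul_mul_intCast_sq`,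
`isBigO_tsum_exp_neg_mul_mul_intCast_sq_sub`), the isosceles right triangle (row g39-#6, IMPORTED for the comparison §3:
`tendsto_isoscelesRightTriangle_cofinite_atTop`, `isBigO_isoscelesRightTriangle_heatTrace_expansion`) and the abstract continuation /
inverse results of rows g37-#1/#3/#6/#10 (`Gamma_mul_tsum_cpow_neg_eq_of_expansion`, `tendsto_continuation_nhdsNE_zero`,
`exists_analyticAt_continuation_zero`, `tendsto_sub_mul_continuation_nhdsNE`, `tendsto_ncard_le_div_rpow_of_expansion`,
`heatCoeff_eq_of_ncard_eq`). Lane `lit-hodgefound` (Track 2 foundations library), prover seat `lit-hodgefound-p06` (generation 39),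
self-proposed row g39-#10. THEOREMS ONLY (no definition, no instance, no notation, no named fact).

## Sources, verbatim

P. Bérard, B. Helffer, *Courant-sharp eigenvalues for the equilateral torus, and for the equilateral triangle*, Lett. Math. Phys.
106 (2016) (arXiv:1503.00117), §2 (chunk p0004): "The group `W` acts simply transitively on the equilateral triangles which tile the
regular hexagon `[A,B,…,E,F]`. The closed regular hexagon `[A,B,…,E,F]` is a fundamental domain for the action of the lattice `Γ`
on `E²`."; §3 (chunk p0005): "we find that the eigenvalues of the equilateral torus `T` are the numbers `λ̂(m,n) = (16π²/9)(m²+mn+n²)`,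
for `m,n ∈ ℤ`"; §4.1 Proposition 4.1 (chunk p0007): "Up to normalization, a complete set of eigenfunctions of the Dirichlet
Laplacian in the equilateral triangle `T = {0,A,B}`, with sides of length `1`, is given by the functions `Φ_p = ∑_{w∈W}ε(w)φ_{w(p)}`
… where `p` ranges over the set `C ∩ Γ*` … The associated eigenvalues are the numbers `4π²|p|²` for `p ∈ C ∩ Γ*`. … Remark. Notice
that `C ∩ Γ* = {mϖ₁ + nϖ₂ | m,n ∈ ℕ•}`, so that the eigenvalues of the equilateral triangle `T`, with sides of length `1`, are the
numbers `(16π²/9)(m²+mn+n²)` for `m, n ∈ ℕ•`." (after Lamé and Bérard, *Spectres et groupes cristallographiques I*, Invent. Math.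
58 (1980)). H. P. McKean, I. M. Singer, J. Differential Geom. 1 (1967), p. 43–44, eq. (4a) (chunk p0001–p0002): "Kac proved that
for `D` bounded by a broken line `B`, `Z = area D/(4πt) − length B/(8√(πt)) + ∑ (π² − γ²)/(24πγ) + o(1)`, the sum running over the
corners, `γ` being the inside-facing angle". M. Kac, Amer. Math. Monthly 73 (1966), §13–§15 (polygonal drums). P. B. Gilkey
(1995), §1.10 Lemma 1.10.1. P. H. Bérard (1986), Ch. III nº31; Ch. VII nº4–nº6, nº10 (ii), nº15. J. H. Conway, N. J. A. Sloane
(1999), Ch. 4 §6.2 (59)–(61) ("`Θ_hex(z) = ∑ q^{x²−xy+y²}` … `= 1 + 6q + 6q³ + 6q⁴ + 12q⁷ + ⋯`").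

## The computation

With `c = 16π²/(9ℓ²)` the Dirichlet spectrum of the equilateral triangle `T_ℓ` of side `ℓ` is `{c(m²+mn+n²) : m,n ≥ 1}` (one
eigenfunction per pair), that of the equilateral torus is `{c(m²+mn+n²) : m,n ∈ ℤ}`. The Weyl group `W` (order 6) acts on the
weight coordinates `(m,n)` by `(m,n) ↦ (−m,m+n)`, `(m+n,−n)`, …, preserving `Q = m²+mn+n²`; `ℤ² ∖ 0` is the disjoint union of the
six open chambers (the sign patterns of `(m,n,m+n)`; e.g. `{m<0<n, m+n>0} = {(−m',m'+n')}` and `{n>0>m+n} = {(−m'−n',m')}`,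
`m',n' ≥ 1`, with `Q(−m',m'+n') = Q(−m'−n',m') = Q(m',n')`) and the six walls `{m=0}`, `{n=0}`, `{m+n=0}` (minus the origin), on
which `Q = k²`. Hence `Θ_hex = 1 + 6·∑_{k≥1}e^{−tck²} + 6·Z_T = 3θ − 2 + 6Z_T`, `θ = ∑_{a∈ℤ}e^{−tca²}`, i.e.
`Z_T = (Θ_hex − 3θ + 2)/6` (§1, assembled from three rearrangements of `ℤ²`: rows `b ≷ 0`, columns `a ≷ 0`, and the
trichotomy of the block `a < 0 < b`). With `Θ_hex = (2π/(√3c))t^{−1} + O(t^∞)` (row g39-#5) and `θ = (π/c)^{1/2}t^{−1/2} + O(t^∞)`: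
`Z_T = (√3/4)ℓ²/(4πt) − 3ℓ/(8√(πt)) + 1/3 + O(t^∞)` — area `(√3/4)ℓ²`, perimeter `3ℓ`, and Kac's three corners `π/3`:
`3·(π²−π²/9)/(24π·π/3) = 1/3`.

## What is proved

* §0 (private) `hasSum_nat_prod_trichotomy`, `hasSum_int_prod_rows`, `hasSum_int_nat_cols`, two reflections, normalisations;
  **`kac_corner_terms_equilateralTriangle`** (`= 1/3`).
* §1 **`summable_exp_neg_mul_equilateralTriangle`**, **`tsum_exp_neg_mul_equilateralTriangle`** (`Z_T = (Θ_hex − 3θ + 2)/6`),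
  **`isBigO_equilateralTriangle_heatTrace_sub`** (`Z_T − ((√3/4)ℓ²/(4π)t^{−1} − 3ℓ/(8√π)t^{−1/2} + 1/3) = O(t^β)` ∀β),
  **`isBigO_equilateralTriangle_heatTrace_sub_kac`** (Kac's (4a) verbatim shape), `isBigO_equilateralTriangle_heatTrace_expansion`
  (`κ = Fin 3`), `tendsto_equilateralTriangle_cofinite_atTop`, `ncard_setOf_equilateralTriangle_eq_zero`.
* §2 **`tendsto_ncard_equilateralTriangle_le_div`** (WEYL `(√3/4)ℓ²/(4π)`), **`Gamma_mul_tsum_equilateralTriangle_cpow_neg_eq`**,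
  **`tendsto_equilateralTriangleZeta_continuation_nhdsNE_zero`** (`ζ_T(0) = 1/3`),
  `exists_analyticAt_equilateralTriangleZeta_continuation_zero`, `tendsto_sub_one_mul_equilateralTriangleZeta_continuation`
  (residue `|T|/(4π)` at `1`).
* §3 **`not_isospectral_equilateralTriangle_rectangle`** (`1/3 ≠ ¼`), **`not_isospectral_equilateralTriangle_isoscelesRightTriangle`**
  (`1/3 ≠ 3/8`), **`eq_of_isospectral_equilateralTriangles`**.

## References

* [BerardHelffer2016] P. Bérard, B. Helffer, *Courant-sharp eigenvalues for the equilateral torus, and for the equilateral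
  triangle*, Lett. Math. Phys. 106 (2016) 1729–1789, doi:10.1007/s11005-016-0819-9, §2, §3, §4.1 Proposition 4.1.
* [McKeanSinger1967] H. P. McKean, I. M. Singer, *Curvature and the eigenvalues of the Laplacian*, J. Differential Geom. 1 (1967)
  43–69, eq. (4a).
* [Kac1966] M. Kac, *Can one hear the shape of a drum?*, Amer. Math. Monthly 73 (1966) 1–23, §13–§15.
* [ConwaySloane1999] J. H. Conway, N. J. A. Sloane, *Sphere Packings, Lattices and Groups*, 3rd ed. (1999), Ch. 4 §6.2.
* [Gilkey1995] P. B. Gilkey, *Invariance theory, the heat equation, and the Atiyah–Singer index theorem*, 2nd ed. (1995), §1.10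
  Lemma 1.10.1.
* [Berard1986] P. H. Bérard, *Spectral Geometry: Direct and Inverse Problems*, LNM 1207 (1986), Ch. III nº31, Ch. VII.
-/

noncomputable section

open Real Filter Topology Set Asymptotics

namespace Literature.Analysis.InnerProduct

/-! ### §0 Rearrangements of `ℤ²` along the Weyl chambers of `A₂`, and normalisations -/

/-- `ℕ² = {x > y} ⊔ {x < y} ⊔ {x = y}` (as in rows g39-#6/#8). [folklore] -/
private theorem hasSum_nat_prod_trichotomy {F : ℕ × ℕ → ℝ} {l u d : ℝ}
    (hl : HasSum (fun q : ℕ × ℕ ↦ F (q.1 + q.2 + 1, q.2)) l) (hu : HasSum (fun q : ℕ × ℕ ↦ F (q.2, q.1 + q.2 + 1)) u)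
    (hd : HasSum (fun n : ℕ ↦ F (n, n)) d) : HasSum F (l + (u + d)) := by
  have hbij : Function.Bijective (Sum.elim (fun q : ℕ × ℕ ↦ (q.1 + q.2 + 1, q.2))
      (Sum.elim (fun q : ℕ × ℕ ↦ (q.2, q.1 + q.2 + 1)) (fun n : ℕ ↦ (n, n)))) := by
    refine ⟨?_, ?_⟩
    · rintro (⟨r, s⟩ | ⟨r, s⟩ | n) (⟨r', s'⟩ | ⟨r', s'⟩ | n') h <;>
        simp only [Sum.elim_inl, Sum.elim_inr, Sum.inl.injEq, Sum.inr.injEq, Prod.mk.injEq, reduceCtorEq] at h ⊢ <;>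
        omega
    · rintro ⟨x, y⟩
      rcases lt_trichotomy y x with hxy | rfl | hxy
      · refine ⟨Sum.inl (x - y - 1, y), ?_⟩
        show (x - y - 1 + y + 1, y) = (x, y)
        rw [show x - y - 1 + y + 1 = x by omega]
      · exact ⟨Sum.inr (Sum.inr y), rfl⟩
      · refine ⟨Sum.inr (Sum.inl (y - x - 1, x)), ?_⟩
        show (x, y - x - 1 + x + 1) = (x, y)
        rw [show y - x - 1 + x + 1 = y by omega]
  exact (Equiv.ofBijective _ hbij).hasSum_iff.mp
    (HasSum.sum (f := F ∘ Sum.elim (fun q : ℕ × ℕ ↦ (q.1 + q.2 + 1, q.2))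
      (Sum.elim (fun q : ℕ × ℕ ↦ (q.2, q.1 + q.2 + 1)) (fun n : ℕ ↦ (n, n)))) hl (HasSum.sum hu hd))

/-- `ℤ² = {b ≥ 1} ⊔ {b = 0} ⊔ {b ≤ −1}` (rows of the lattice). [folklore] -/
private theorem hasSum_int_prod_rows {F : ℤ × ℤ → ℝ} {u z d : ℝ} (hu : HasSum (fun q : ℤ × ℕ ↦ F (q.1, (q.2 : ℤ) + 1)) u)
    (hz : HasSum (fun a : ℤ ↦ F (a, 0)) z) (hd : HasSum (fun q : ℤ × ℕ ↦ F (q.1, -((q.2 : ℤ) + 1))) d) :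
    HasSum F (u + (z + d)) := by
  have hbij : Function.Bijective (Sum.elim (fun q : ℤ × ℕ ↦ (q.1, (q.2 : ℤ) + 1))
      (Sum.elim (fun a : ℤ ↦ (a, (0 : ℤ))) (fun q : ℤ × ℕ ↦ (q.1, -((q.2 : ℤ) + 1))))) := by
    refine ⟨?_, ?_⟩
    · rintro (⟨r, s⟩ | a | ⟨r, s⟩) (⟨r', s'⟩ | a' | ⟨r', s'⟩) h <;>
        simp only [Sum.elim_inl, Sum.elim_inr, Sum.inl.injEq, Sum.inr.injEq, Prod.mk.injEq, reduceCtorEq] at h ⊢ <;>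
        omega
    · rintro ⟨x, y⟩
      rcases lt_trichotomy 0 y with hy | rfl | hy
      · refine ⟨Sum.inl (x, (y - 1).toNat), ?_⟩
        show (x, (((y - 1).toNat : ℕ) : ℤ) + 1) = (x, y)
        rw [Int.toNat_of_nonneg (by omega)]
        ring_nf
      · exact ⟨Sum.inr (Sum.inl x), rfl⟩
      · refine ⟨Sum.inr (Sum.inr (x, (-y - 1).toNat)), ?_⟩
        show (x, -((((-y - 1).toNat : ℕ) : ℤ) + 1)) = (x, y)
        rw [Int.toNat_of_nonneg (by omega)]
        ring_nf
  exact (Equiv.ofBijective _ hbij).hasSum_iff.mp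
    (HasSum.sum (f := F ∘ Sum.elim (fun q : ℤ × ℕ ↦ (q.1, (q.2 : ℤ) + 1))
      (Sum.elim (fun a : ℤ ↦ (a, (0 : ℤ))) (fun q : ℤ × ℕ ↦ (q.1, -((q.2 : ℤ) + 1))))) hu (HasSum.sum hz hd))

/-- `ℤ × ℕ = {a ≥ 1} ⊔ {a = 0} ⊔ {a ≤ −1}` (columns of a half-lattice). [folklore] -/
private theorem hasSum_int_nat_cols {G : ℤ × ℕ → ℝ} {p z m : ℝ} (hp : HasSum (fun q : ℕ × ℕ ↦ G ((q.1 : ℤ) + 1, q.2)) p)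
    (hz : HasSum (fun j : ℕ ↦ G (0, j)) z) (hm : HasSum (fun q : ℕ × ℕ ↦ G (-((q.1 : ℤ) + 1), q.2)) m) :
    HasSum G (p + (z + m)) := by
  have hbij : Function.Bijective (Sum.elim (fun q : ℕ × ℕ ↦ (((q.1 : ℤ) + 1), q.2))
      (Sum.elim (fun j : ℕ ↦ ((0 : ℤ), j)) (fun q : ℕ × ℕ ↦ (-((q.1 : ℤ) + 1), q.2)))) := by
    refine ⟨?_, ?_⟩
    · rintro (⟨r, s⟩ | j | ⟨r, s⟩) (⟨r', s'⟩ | j' | ⟨r', s'⟩) h <;>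
        simp only [Sum.elim_inl, Sum.elim_inr, Sum.inl.injEq, Sum.inr.injEq, Prod.mk.injEq, reduceCtorEq] at h ⊢ <;>
        omega
    · rintro ⟨x, y⟩
      rcases lt_trichotomy 0 x with hx | rfl | hx
      · refine ⟨Sum.inl ((x - 1).toNat, y), ?_⟩
        show ((((x - 1).toNat : ℕ) : ℤ) + 1, y) = (x, y)
        rw [Int.toNat_of_nonneg (by omega)]
        ring_nf
      · exact ⟨Sum.inr (Sum.inl y), rfl⟩
      · refine ⟨Sum.inr (Sum.inr ((-x - 1).toNat, y)), ?_⟩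
        show (-((((-x - 1).toNat : ℕ) : ℤ) + 1), y) = (x, y)
        rw [Int.toNat_of_nonneg (by omega)]
        ring_nf
  exact (Equiv.ofBijective _ hbij).hasSum_iff.mp
    (HasSum.sum (f := G ∘ Sum.elim (fun q : ℕ × ℕ ↦ (((q.1 : ℤ) + 1), q.2))
      (Sum.elim (fun j : ℕ ↦ ((0 : ℤ), j)) (fun q : ℕ × ℕ ↦ (-((q.1 : ℤ) + 1), q.2)))) hp (HasSum.sum hz hm))

/-- The reflections `(a,b) ↦ (−a,b)` of `ℤ × ℕ` and `(a,b) ↦ (a,−b)` of `ℤ × ℤ` are bijections. [folklore] -/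
private theorem bijective_neg_fst : Function.Bijective fun q : ℤ × ℕ ↦ (-q.1, q.2) :=
  ⟨fun q q' h ↦ by
    simp only [Prod.mk.injEq, neg_inj] at h
    exact Prod.ext h.1 h.2,
   fun q ↦ ⟨(-q.1, q.2), by simp⟩⟩

/-- The reflection `(a,b) ↦ (a,−b)` of `ℤ × ℤ` is a bijection. [folklore] -/
private theorem bijective_neg_snd : Function.Bijective fun p : ℤ × ℤ ↦ (p.1, -p.2) :=
  ⟨fun p p' h ↦ by
    simp only [Prod.mk.injEq, neg_inj] at h
    exact Prod.ext h.1 h.2,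
   fun p ↦ ⟨(p.1, -p.2), by simp⟩⟩

/-- `π/(3ℓ/4) = 4π/(3ℓ)`: the scale `c = 16π²/(9ℓ²)` is `(π/a)²` for the interval of length `a = 3ℓ/4`. [folklore] -/
private theorem pi_div_three_mul_div_four {ℓ : ℝ} (hℓ : 0 < ℓ) : π / (3 * ℓ / 4) = 4 * π / (3 * ℓ) := by
  field_simp

/-- `(π/(π/a)²)^{1/2} = a/√π`. [folklore] -/
private theorem sqrt_pi_div_pi_div_sq'' {a : ℝ} (ha : 0 < a) : (π / (π / a) ^ 2) ^ (1 / 2 : ℝ) = a / π ^ (1 / 2 : ℝ) := by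
  have hπ := Real.pi_pos
  rw [show π / (π / a) ^ 2 = a ^ 2 / π by field_simp, Real.div_rpow (sq_nonneg a) hπ.le, ← Real.rpow_natCast a 2,
    ← Real.rpow_mul ha.le]
  norm_num

/-- The area coefficient: `(1/6)·2π/(√3c) = (√3/4)ℓ²/(4π)` for `c = 16π²/(9ℓ²)` (`|T| = (√3/4)ℓ²`). [folklore] -/
private theorem equilateral_area_coeff {ℓ : ℝ} (hℓ : 0 < ℓ) :
    1 / 6 * (2 * π / (Real.sqrt 3 * (4 * π / (3 * ℓ)) ^ 2)) = Real.sqrt 3 * ℓ ^ 2 / (16 * π) := by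
  have hs0 : Real.sqrt 3 ≠ 0 := (Real.sqrt_pos.mpr (by norm_num)).ne'
  have h3 : 3 / Real.sqrt 3 = Real.sqrt 3 := by
    rw [div_eq_iff hs0]
    exact (Real.mul_self_sqrt (by norm_num : (0 : ℝ) ≤ 3)).symm
  conv_rhs => rw [← h3]
  have hπ := Real.pi_pos.ne'
  field_simp
  ring

/-- **KAC'S CORNER TERMS FOR THE EQUILATERAL TRIANGLE**: three inside-facing angles `π/3`, `3·(π² − (π/3)²)/(24π·π/3) = 1/3`.
[cite: McKeanSinger1967, eq. (4a) p. 43–44] -/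
theorem kac_corner_terms_equilateralTriangle : 3 * ((π ^ 2 - (π / 3) ^ 2) / (24 * π * (π / 3))) = (1 / 3 : ℝ) := by
  have hπ : π ≠ 0 := Real.pi_pos.ne'
  field_simp
  ring

/-! ### §1 The Dirichlet spectrum of the equilateral triangle and `Z_T = (Θ_hex − 3θ + 2)/6` -/

section Triangle

variable {ℓ : ℝ}

/-- **THE DIRICHLET SPECTRUM OF THE EQUILATERAL TRIANGLE `T_ℓ` OF SIDE `ℓ` AS A FAMILY**: "the eigenvalues of the equilateral
triangle `T`, with sides of length `1`, are the numbers `(16π²/9)(m² + mn + n²)` for `m, n ∈ ℕ∖{0}`" (one eigenfunction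
`Φ_p = ∑_{w∈W}ε(w)e^{2iπ⟨x,w(p)⟩}` for each `p = mϖ₁ + nϖ₂` in the open Weyl chamber); for side `ℓ` scale by `ℓ^{−2}`. Index
`(j,k) ∈ ℕ × ℕ`, `m = j+1`, `n = k+1`. The heat trace converges (`m² + mn + n² ≥ m² + n²`: comparison with the square `[0,3ℓ/4]²`).
[cite: BerardHelffer2016, §4.1 Proposition 4.1 and Remark ("`C ∩ Γ* = {mϖ₁ + nϖ₂ | m,n ∈ ℕ•}`, so that the eigenvalues of the
equilateral triangle `T`, with sides of length `1`, are the numbers `(16π²/9)(m²+mn+n²)`"); Berard1986, Ch. III nº31] -/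
theorem summable_exp_neg_mul_equilateralTriangle (hℓ : 0 < ℓ) {t : ℝ} (ht : 0 < t) :
    Summable fun p : ℕ × ℕ ↦ Real.exp (-(t * ((4 * π / (3 * ℓ)) ^ 2 * (((p.1 : ℝ) + 1) ^ 2 + ((p.1 : ℝ) + 1) * ((p.2 : ℝ) + 1) + ((p.2 : ℝ) + 1) ^ 2)))) := by
  have ha : (0 : ℝ) < 3 * ℓ / 4 := by positivity
  have hR := summable_exp_neg_mul_dirichletRectangle ha ha ht
  rw [pi_div_three_mul_div_four hℓ] at hR
  refine Summable.of_nonneg_of_le (fun p ↦ Real.exp_nonneg _) (fun p ↦ ?_) hR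
  rw [Real.exp_le_exp]
  have h1 : (0 : ℝ) ≤ ((p.1 : ℝ) + 1) * ((p.2 : ℝ) + 1) := by positivity
  have hc : (0 : ℝ) ≤ (4 * π / (3 * ℓ)) ^ 2 := sq_nonneg _
  nlinarith [mul_nonneg hc h1, ht]

/-- **`Z_{T_ℓ}(t) = (Θ_hex(t) − 3θ(t) + 2)/6`**, `Θ_hex(t) = ∑_{(m,n)∈ℤ²}e^{−tc(m²−mn+n²)}` (the equilateral torus, row g39-#5),
`θ(t) = ∑_{a∈ℤ}e^{−tca²}`, `c = 16π²/(9ℓ²)`: the weight lattice `Γ* ≅ ℤ²` is the disjoint union of the six open Weyl chambers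
`w(C)` (each carrying a copy of the triangle's spectrum), the six walls (each `≅ {k ≥ 1}`, eigenvalue `ck²`) and the origin, so
`Θ_hex = 6Z_T + 3(θ − 1) + 1`. In coordinates `p = mϖ₁ + nϖ₂`: chambers = sign patterns of `(m, n, m+n)`, walls `m = 0`, `n = 0`,
`m + n = 0`. [cite: BerardHelffer2016, §2 ("The group `W` acts simply transitively on the equilateral triangles which tile the
regular hexagon") and Proposition 4.1 (proof: "we extend it to a function `ψ` on `E²` using the symmetries … `ψ∘w = ε(w)ψ`");
ConwaySloane1999, Ch. 4 §6.2 (59)–(60)] -/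
theorem tsum_exp_neg_mul_equilateralTriangle (hℓ : 0 < ℓ) {t : ℝ} (ht : 0 < t) :
    ∑' p : ℕ × ℕ, Real.exp (-(t * ((4 * π / (3 * ℓ)) ^ 2 * (((p.1 : ℝ) + 1) ^ 2 + ((p.1 : ℝ) + 1) * ((p.2 : ℝ) + 1) + ((p.2 : ℝ) + 1) ^ 2)))) =
      ((∑' p : ℤ × ℤ, Real.exp (-(t * ((4 * π / (3 * ℓ)) ^ 2 * (((p.1 : ℝ)) ^ 2 - (p.1 : ℝ) * (p.2 : ℝ) + ((p.2 : ℝ)) ^ 2))))) - 3 * (∑' a : ℤ, Real.exp (-(t * ((4 * π / (3 * ℓ)) ^ 2 * ((a : ℝ)) ^ 2)))) + 2) / 6 := by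
  have ha : (0 : ℝ) < 3 * ℓ / 4 := by positivity
  have hc : (0 : ℝ) < (4 * π / (3 * ℓ)) ^ 2 := by positivity
  -- the three building blocks `Z`, `W = ∑_{k≥1} e^{−tck²}`, `θ`
  have hZ := (summable_exp_neg_mul_equilateralTriangle hℓ ht).hasSum
  have hWs := summable_exp_neg_mul_dirichletInterval ha ht
  rw [pi_div_three_mul_div_four hℓ] at hWs
  have hW := hWs.hasSum
  have hWθ := tsum_exp_neg_mul_dirichletInterval_eq ha ht
  rw [pi_div_three_mul_div_four hℓ] at hWθ
  have hθ := (summable_exp_neg_mul_mul_intCast_sq hc ht).hasSum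
  -- (1) the block `a ≤ −1`, `b ≥ 1`: two chambers and the wall `a + b = 0`
  have h1 : HasSum (fun q : ℕ × ℕ ↦ Real.exp (-(t * ((4 * π / (3 * ℓ)) ^ 2 * ((((-((q.1 : ℤ) + 1)) : ℤ) : ℝ) ^ 2 + (((-((q.1 : ℤ) + 1)) : ℤ) : ℝ) * ((((q.2 : ℤ) + 1) : ℤ) : ℝ) + ((((q.2 : ℤ) + 1) : ℤ) : ℝ) ^ 2)))))
      ((∑' p : ℕ × ℕ, Real.exp (-(t * ((4 * π / (3 * ℓ)) ^ 2 * (((p.1 : ℝ) + 1) ^ 2 + ((p.1 : ℝ) + 1) * ((p.2 : ℝ) + 1) + ((p.2 : ℝ) + 1) ^ 2))))) + ((∑' p : ℕ × ℕ, Real.exp (-(t * ((4 * π / (3 * ℓ)) ^ 2 * (((p.1 : ℝ) + 1) ^ 2 + ((p.1 : ℝ) + 1) * ((p.2 : ℝ) + 1) + ((p.2 : ℝ) + 1) ^ 2))))) +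
        ∑' n : ℕ, Real.exp (-(t * ((4 * π / (3 * ℓ)) ^ 2 * ((n : ℝ) + 1) ^ 2))))) :=
    hasSum_nat_prod_trichotomy (F := fun q : ℕ × ℕ ↦ Real.exp (-(t * ((4 * π / (3 * ℓ)) ^ 2 * ((((-((q.1 : ℤ) + 1)) : ℤ) : ℝ) ^ 2 + (((-((q.1 : ℤ) + 1)) : ℤ) : ℝ) * ((((q.2 : ℤ) + 1) : ℤ) : ℝ) + ((((q.2 : ℤ) + 1) : ℤ) : ℝ) ^ 2)))))
      (hZ.congr_fun fun q ↦ by dsimp only; congr 1; push_cast; ring)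
      (hZ.congr_fun fun q ↦ by dsimp only; congr 1; push_cast; ring)
      (hW.congr_fun fun n ↦ by dsimp only; congr 1; push_cast; ring)
  -- (2) the rows `b ≥ 1`: the chamber `a ≥ 1`, the wall `a = 0`, and the block (1)
  have h2 : HasSum (fun q : ℤ × ℕ ↦ Real.exp (-(t * ((4 * π / (3 * ℓ)) ^ 2 * ((((q.1) : ℤ) : ℝ) ^ 2 + (((q.1) : ℤ) : ℝ) * ((((q.2 : ℤ) + 1) : ℤ) : ℝ) + ((((q.2 : ℤ) + 1) : ℤ) : ℝ) ^ 2)))))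
      ((∑' p : ℕ × ℕ, Real.exp (-(t * ((4 * π / (3 * ℓ)) ^ 2 * (((p.1 : ℝ) + 1) ^ 2 + ((p.1 : ℝ) + 1) * ((p.2 : ℝ) + 1) + ((p.2 : ℝ) + 1) ^ 2))))) + ((∑' n : ℕ, Real.exp (-(t * ((4 * π / (3 * ℓ)) ^ 2 * ((n : ℝ) + 1) ^ 2)))) +
        ((∑' p : ℕ × ℕ, Real.exp (-(t * ((4 * π / (3 * ℓ)) ^ 2 * (((p.1 : ℝ) + 1) ^ 2 + ((p.1 : ℝ) + 1) * ((p.2 : ℝ) + 1) + ((p.2 : ℝ) + 1) ^ 2))))) + ((∑' p : ℕ × ℕ, Real.exp (-(t * ((4 * π / (3 * ℓ)) ^ 2 * (((p.1 : ℝ) + 1) ^ 2 + ((p.1 : ℝ) + 1) * ((p.2 : ℝ) + 1) + ((p.2 : ℝ) + 1) ^ 2))))) +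
          ∑' n : ℕ, Real.exp (-(t * ((4 * π / (3 * ℓ)) ^ 2 * ((n : ℝ) + 1) ^ 2))))))) :=
    hasSum_int_nat_cols (G := fun q : ℤ × ℕ ↦ Real.exp (-(t * ((4 * π / (3 * ℓ)) ^ 2 * ((((q.1) : ℤ) : ℝ) ^ 2 + (((q.1) : ℤ) : ℝ) * ((((q.2 : ℤ) + 1) : ℤ) : ℝ) + ((((q.2 : ℤ) + 1) : ℤ) : ℝ) ^ 2)))))
      (hZ.congr_fun fun q ↦ by dsimp only; congr 1; push_cast; ring)
      (hW.congr_fun fun n ↦ by dsimp only; congr 1; push_cast; ring)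
      (h1.congr_fun fun q ↦ by dsimp only)
  -- (3) the rows `b ≤ −1`, by the symmetry `(a,b) ↦ (−a,−b)` composed with `a ↦ −a`
  have h3 : HasSum (fun q : ℤ × ℕ ↦ Real.exp (-(t * ((4 * π / (3 * ℓ)) ^ 2 * ((((q.1) : ℤ) : ℝ) ^ 2 + (((q.1) : ℤ) : ℝ) * (((-((q.2 : ℤ) + 1)) : ℤ) : ℝ) + (((-((q.2 : ℤ) + 1)) : ℤ) : ℝ) ^ 2)))))
      ((∑' p : ℕ × ℕ, Real.exp (-(t * ((4 * π / (3 * ℓ)) ^ 2 * (((p.1 : ℝ) + 1) ^ 2 + ((p.1 : ℝ) + 1) * ((p.2 : ℝ) + 1) + ((p.2 : ℝ) + 1) ^ 2))))) + ((∑' n : ℕ, Real.exp (-(t * ((4 * π / (3 * ℓ)) ^ 2 * ((n : ℝ) + 1) ^ 2)))) +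
        ((∑' p : ℕ × ℕ, Real.exp (-(t * ((4 * π / (3 * ℓ)) ^ 2 * (((p.1 : ℝ) + 1) ^ 2 + ((p.1 : ℝ) + 1) * ((p.2 : ℝ) + 1) + ((p.2 : ℝ) + 1) ^ 2))))) + ((∑' p : ℕ × ℕ, Real.exp (-(t * ((4 * π / (3 * ℓ)) ^ 2 * (((p.1 : ℝ) + 1) ^ 2 + ((p.1 : ℝ) + 1) * ((p.2 : ℝ) + 1) + ((p.2 : ℝ) + 1) ^ 2))))) +
          ∑' n : ℕ, Real.exp (-(t * ((4 * π / (3 * ℓ)) ^ 2 * ((n : ℝ) + 1) ^ 2))))))) := by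
    refine (Equiv.ofBijective _ bijective_neg_fst).hasSum_iff.mp (h2.congr_fun fun q ↦ ?_)
    simp only [Function.comp_apply, Equiv.ofBijective_apply]
    congr 1
    push_cast
    ring
  -- (4) all of `ℤ²`
  have h4 := hasSum_int_prod_rows (F := fun p : ℤ × ℤ ↦ Real.exp (-(t * ((4 * π / (3 * ℓ)) ^ 2 * ((((p.1) : ℤ) : ℝ) ^ 2 + (((p.1) : ℤ) : ℝ) * (((p.2) : ℤ) : ℝ) + (((p.2) : ℤ) : ℝ) ^ 2))))) h2
    (hθ.congr_fun fun a ↦ by dsimp only; congr 1; push_cast; ring) h3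
  -- (5) `∑_{ℤ²} e^{−tc(m²+mn+n²)} = Θ_hex` by `(m,n) ↦ (m,−n)`
  have h5 : ∑' p : ℤ × ℤ, Real.exp (-(t * ((4 * π / (3 * ℓ)) ^ 2 * (((p.1 : ℝ)) ^ 2 - (p.1 : ℝ) * (p.2 : ℝ) + ((p.2 : ℝ)) ^ 2)))) = ∑' p : ℤ × ℤ, Real.exp (-(t * ((4 * π / (3 * ℓ)) ^ 2 * ((((p.1) : ℤ) : ℝ) ^ 2 + (((p.1) : ℤ) : ℝ) * (((p.2) : ℤ) : ℝ) + (((p.2) : ℤ) : ℝ) ^ 2)))) := by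
    rw [← (Equiv.ofBijective _ bijective_neg_snd).tsum_eq]
    refine tsum_congr fun p ↦ ?_
    simp only [Equiv.ofBijective_apply]
    congr 1
    push_cast
    ring
  rw [h5, h4.tsum_eq, hWθ]
  ring

/-- **KAC'S FORMULA FOR LAMÉ'S TRIANGLE, TO ALL ORDERS:
`Z_{T_ℓ}(t) − ((√3/4)ℓ²/(4π)·t^{−1} − 3ℓ/(8√π)·t^{−1/2} + 1/3) = O(t^β)` for EVERY `β`** — area `|T_ℓ| = (√3/4)ℓ²`, perimeter
`3ℓ`, three corners `π/3` contributing `3·(1/9) = 1/3`, exponentially small remainder: `(1/6)(Θ_hex − 2π/(√3c)t^{−1}) −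
½(θ − (π/c)^{1/2}t^{−1/2})` with rows g39-#5 (`Θ_hex`) and g38-#2 (`θ`). [cite: McKeanSinger1967, eq. (4a) p. 43–44 ("Kac proved that for
`D` bounded by a broken line `B`, `Z = area D/(4πt) − length B/(8√(πt)) +` the sum over the corners of `(π²−γ²)/(24πγ) + o(1)`");
BerardHelffer2016, Proposition 4.1; Kac1966, §14] -/
theorem isBigO_equilateralTriangle_heatTrace_sub (hℓ : 0 < ℓ) (β : ℝ) :
    (fun t : ℝ ↦ ∑' p : ℕ × ℕ, Real.exp (-(t * ((4 * π / (3 * ℓ)) ^ 2 * (((p.1 : ℝ) + 1) ^ 2 + ((p.1 : ℝ) + 1) * ((p.2 : ℝ) + 1) + ((p.2 : ℝ) + 1) ^ 2)))) -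
      (Real.sqrt 3 * ℓ ^ 2 / (16 * π) * t ^ (-1 : ℝ) - 3 * ℓ / (8 * π ^ (1 / 2 : ℝ)) * t ^ (-(1 / 2 : ℝ)) + 1 / 3))
      =O[𝓝[>] 0] fun t : ℝ ↦ t ^ β := by
  have ha : (0 : ℝ) < 3 * ℓ / 4 := by positivity
  have hc : (0 : ℝ) < (4 * π / (3 * ℓ)) ^ 2 := by positivity
  have hH := isBigO_hexagonalTorus_heatTrace_sub hc β
  have hθ := isBigO_tsum_exp_neg_mul_mul_intCast_sq_sub hc β
  have e1 := equilateral_area_coeff hℓ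
  have e2 : (π / (4 * π / (3 * ℓ)) ^ 2) ^ (1 / 2 : ℝ) = 3 * ℓ / 4 / π ^ (1 / 2 : ℝ) := by
    rw [← pi_div_three_mul_div_four hℓ, sqrt_pi_div_pi_div_sq'' ha]
  refine ((hH.const_mul_left (1 / 6)).sub (hθ.const_mul_left (1 / 2))).congr' ?_ EventuallyEq.rfl
  filter_upwards [self_mem_nhdsWithin] with t (ht : 0 < t)
  rw [tsum_exp_neg_mul_equilateralTriangle hℓ ht, e2]
  linear_combination (-(t ^ (-1 : ℝ))) * e1

/-- **KAC'S FORMULA (4a), VERBATIM SHAPE, FOR `T_ℓ`: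
`Z(t) − (area/(4πt) − length/(8√(πt)) + ∑_corners (π²−γ²)/(24πγ)) = O(t^β)`**, `area = (√3/4)ℓ²`, `length = 3ℓ`, three corners
`γ = π/3`; Kac's `o(1)` is `O(t^∞)` for this triangle. [cite: McKeanSinger1967, eq. (4a) p. 43–44 and footnote 1; Kac1966, §14] -/
theorem isBigO_equilateralTriangle_heatTrace_sub_kac (hℓ : 0 < ℓ) (β : ℝ) :
    (fun t : ℝ ↦ ∑' p : ℕ × ℕ, Real.exp (-(t * ((4 * π / (3 * ℓ)) ^ 2 * (((p.1 : ℝ) + 1) ^ 2 + ((p.1 : ℝ) + 1) * ((p.2 : ℝ) + 1) + ((p.2 : ℝ) + 1) ^ 2)))) -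
      (Real.sqrt 3 / 4 * ℓ ^ 2 / (4 * π * t) - 3 * ℓ / (8 * (π * t) ^ (1 / 2 : ℝ)) +
        3 * ((π ^ 2 - (π / 3) ^ 2) / (24 * π * (π / 3))))) =O[𝓝[>] 0] fun t : ℝ ↦ t ^ β := by
  refine (isBigO_equilateralTriangle_heatTrace_sub hℓ β).congr' ?_ EventuallyEq.rfl
  filter_upwards [self_mem_nhdsWithin] with t (ht : 0 < t)
  have hsq : π ^ (1 / 2 : ℝ) * π ^ (1 / 2 : ℝ) = π := by
    rw [← Real.rpow_add Real.pi_pos]; norm_num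
  have hs0 : π ^ (1 / 2 : ℝ) ≠ 0 := (Real.rpow_pos_of_pos Real.pi_pos _).ne'
  have hu0 : t ^ (1 / 2 : ℝ) ≠ 0 := (Real.rpow_pos_of_pos ht _).ne'
  have ht0 : t ≠ 0 := ht.ne'
  rw [kac_corner_terms_equilateralTriangle, Real.mul_rpow Real.pi_pos.le ht.le, Real.rpow_neg_one, Real.rpow_neg ht.le]
  congr 1
  set s := π ^ (1 / 2 : ℝ) with hs_def
  set u := t ^ (1 / 2 : ℝ) with hu_def
  rw [show π = s * s from hsq.symm]
  field_simp
  ring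

/-- The expansion in the format of the abstract theory: `κ = Fin 3`, `a = ((√3/4)ℓ²/(4π), −3ℓ/(8√π), 1/3)`, `α = (−1, −½, 0)`.
[cite: McKeanSinger1967, eq. (4a); Gilkey1995, §1.10 Lemma 1.10.1 (the expansion hypothesis)] -/
theorem isBigO_equilateralTriangle_heatTrace_expansion (hℓ : 0 < ℓ) (β : ℝ) :
    (fun t : ℝ ↦ ∑' p : ℕ × ℕ, Real.exp (-(t * ((4 * π / (3 * ℓ)) ^ 2 * (((p.1 : ℝ) + 1) ^ 2 + ((p.1 : ℝ) + 1) * ((p.2 : ℝ) + 1) + ((p.2 : ℝ) + 1) ^ 2)))) -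
      ∑ k : Fin 3, (![Real.sqrt 3 * ℓ ^ 2 / (16 * π), -(3 * ℓ / (8 * π ^ (1 / 2 : ℝ))), 1 / 3] : Fin 3 → ℝ) k *
        t ^ ((![(-1 : ℝ), -(1 / 2 : ℝ), 0] : Fin 3 → ℝ) k)) =O[𝓝[>] 0] fun t : ℝ ↦ t ^ β := by
  refine (isBigO_equilateralTriangle_heatTrace_sub hℓ β).congr' ?_ EventuallyEq.rfl
  filter_upwards [self_mem_nhdsWithin] with t (ht : 0 < t)
  simp only [Fin.sum_univ_three, Matrix.cons_val_zero, Matrix.cons_val_one, Matrix.cons_val, Real.rpow_zero, mul_one]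
  ring

/-- The Dirichlet spectrum of `T_ℓ` is discrete. [cite: BerardHelffer2016, Proposition 4.1] -/
theorem tendsto_equilateralTriangle_cofinite_atTop (hℓ : 0 < ℓ) :
    Tendsto (fun p : ℕ × ℕ ↦ (4 * π / (3 * ℓ)) ^ 2 * (((p.1 : ℝ) + 1) ^ 2 + ((p.1 : ℝ) + 1) * ((p.2 : ℝ) + 1) + ((p.2 : ℝ) + 1) ^ 2)) cofinite atTop := by
  have ha : (0 : ℝ) < 3 * ℓ / 4 := by positivity
  have hR := tendsto_dirichletRectangle_cofinite_atTop ha ha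
  rw [pi_div_three_mul_div_four hℓ] at hR
  refine tendsto_atTop_mono (fun p ↦ ?_) hR
  have h1 : (0 : ℝ) ≤ ((p.1 : ℝ) + 1) * ((p.2 : ℝ) + 1) := by positivity
  have hc : (0 : ℝ) ≤ (4 * π / (3 * ℓ)) ^ 2 := sq_nonneg _
  nlinarith [mul_nonneg hc h1]

/-- No zero modes (Dirichlet). [cite: BerardHelffer2016, Proposition 4.1] -/
theorem ncard_setOf_equilateralTriangle_eq_zero (hℓ : 0 < ℓ) :
    {p : ℕ × ℕ | (4 * π / (3 * ℓ)) ^ 2 * (((p.1 : ℝ) + 1) ^ 2 + ((p.1 : ℝ) + 1) * ((p.2 : ℝ) + 1) + ((p.2 : ℝ) + 1) ^ 2) = 0}.ncard = 0 := by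
  have h : {p : ℕ × ℕ | (4 * π / (3 * ℓ)) ^ 2 * (((p.1 : ℝ) + 1) ^ 2 + ((p.1 : ℝ) + 1) * ((p.2 : ℝ) + 1) + ((p.2 : ℝ) + 1) ^ 2) = 0} = ∅ :=
    Set.eq_empty_of_forall_notMem fun p hp ↦ by
      have : (0 : ℝ) < (4 * π / (3 * ℓ)) ^ 2 * (((p.1 : ℝ) + 1) ^ 2 + ((p.1 : ℝ) + 1) * ((p.2 : ℝ) + 1) + ((p.2 : ℝ) + 1) ^ 2) := by positivity
      exact this.ne' hp
  rw [h, Set.ncard_empty]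

/-! ### §2 Consequences: Weyl `(√3/4)ℓ²/(4π)`, `Γζ_T` with poles at `1`, `½`, and `ζ_T(0) = 1/3` -/

/-- **WEYL'S LAW FOR THE EQUILATERAL TRIANGLE: `#{λ ≤ Λ}/Λ → (√3/4)ℓ²/(4π) = |T_ℓ|/(4π)`** ("you can hear the area").
[cite: McKeanSinger1967, p. 43; Berard1986, Ch. VII nº10 (ii), nº15 (16)] -/
theorem tendsto_ncard_equilateralTriangle_le_div (hℓ : 0 < ℓ) :
    Tendsto (fun l : ℝ ↦ (({p : ℕ × ℕ | (4 * π / (3 * ℓ)) ^ 2 * (((p.1 : ℝ) + 1) ^ 2 + ((p.1 : ℝ) + 1) * ((p.2 : ℝ) + 1) + ((p.2 : ℝ) + 1) ^ 2) ≤ l}.ncard : ℕ) : ℝ) / l) atTop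
      (𝓝 (Real.sqrt 3 * ℓ ^ 2 / (16 * π))) := by
  have hexp : (fun t : ℝ ↦ ∑' p : ℕ × ℕ, Real.exp (-(((4 * π / (3 * ℓ)) ^ 2 * (((p.1 : ℝ) + 1) ^ 2 + ((p.1 : ℝ) + 1) * ((p.2 : ℝ) + 1) + ((p.2 : ℝ) + 1) ^ 2)) * t)) -
      ∑ k : Fin 3, (![Real.sqrt 3 * ℓ ^ 2 / (16 * π), -(3 * ℓ / (8 * π ^ (1 / 2 : ℝ))), 1 / 3] : Fin 3 → ℝ) k *
        t ^ ((![(-1 : ℝ), -(1 / 2 : ℝ), 0] : Fin 3 → ℝ) k)) =O[𝓝[>] 0] fun t : ℝ ↦ t ^ (0 : ℝ) := by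
    refine (isBigO_equilateralTriangle_heatTrace_expansion hℓ 0).congr' ?_ EventuallyEq.rfl
    filter_upwards with t
    congr 1
    exact tsum_congr fun p ↦ by rw [mul_comm]
  have hsum : ∀ t : ℝ, 0 < t → Summable fun p : ℕ × ℕ ↦ Real.exp (-(((4 * π / (3 * ℓ)) ^ 2 * (((p.1 : ℝ) + 1) ^ 2 + ((p.1 : ℝ) + 1) * ((p.2 : ℝ) + 1) + ((p.2 : ℝ) + 1) ^ 2)) * t)) :=
    fun t ht ↦ (summable_exp_neg_mul_equilateralTriangle hℓ ht).congr fun p ↦ by rw [mul_comm]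
  have h := tendsto_ncard_le_div_rpow_of_expansion (μ := fun p : ℕ × ℕ ↦ (4 * π / (3 * ℓ)) ^ 2 * (((p.1 : ℝ) + 1) ^ 2 + ((p.1 : ℝ) + 1) * ((p.2 : ℝ) + 1) + ((p.2 : ℝ) + 1) ^ 2)) (ρ := 1)
    (fun p ↦ by positivity) hsum hexp (fun k ↦ by fin_cases k <;> norm_num) (by norm_num) (by norm_num)
  have e : (∑ k : Fin 3, if (![(-1 : ℝ), -(1 / 2 : ℝ), 0] : Fin 3 → ℝ) k = -1 then
      (![Real.sqrt 3 * ℓ ^ 2 / (16 * π), -(3 * ℓ / (8 * π ^ (1 / 2 : ℝ))), 1 / 3] : Fin 3 → ℝ) k else 0) / Real.Gamma (1 + 1) =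
      Real.sqrt 3 * ℓ ^ 2 / (16 * π) := by
    rw [Fin.sum_univ_three]
    simp only [Matrix.cons_val_zero, Matrix.cons_val_one, Matrix.cons_val, if_true,
      show ¬(-(1 / 2 : ℝ) = -1) by norm_num, show ¬((0 : ℝ) = -1) by norm_num, if_false, add_zero,
      show (1 : ℝ) + 1 = 2 by norm_num, Real.Gamma_two, div_one]
  rw [e] at h
  refine h.congr' ?_
  filter_upwards with l
  rw [Real.rpow_one]

/-- **GILKEY'S LEMMA 1.10.1 FOR THE EQUILATERAL TRIANGLE: on `Re s > 1`, `Γ(s)·ζ_T(s) = ∑ₖ aₖ/(s + αₖ) − 0/s + r(s)`**,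
`(aₖ) = ((√3/4)ℓ²/(4π), −3ℓ/(8√π), 1/3)`, `(αₖ) = (−1, −½, 0)`, `r` entire — `ζ_T(s) = c^{−s}∑_{m,n≥1}(m²+mn+n²)^{−s}` has simple
poles at `1` (area) and `½` (perimeter) and `Γζ_T` the corner pole `(1/3)/s`. [cite: Gilkey1995, §1.10 Lemma 1.10.1; McKeanSinger1967,
eq. (4a)] -/
theorem Gamma_mul_tsum_equilateralTriangle_cpow_neg_eq (hℓ : 0 < ℓ) {s : ℂ} (hs : 1 < s.re) :
    Complex.Gamma s * ∑' p : {p : ℕ × ℕ | (4 * π / (3 * ℓ)) ^ 2 * (((p.1 : ℝ) + 1) ^ 2 + ((p.1 : ℝ) + 1) * ((p.2 : ℝ) + 1) + ((p.2 : ℝ) + 1) ^ 2) ≠ 0},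
        ((((4 * π / (3 * ℓ)) ^ 2 * ((((p : ℕ × ℕ).1 : ℝ) + 1) ^ 2 + (((p : ℕ × ℕ).1 : ℝ) + 1) * (((p : ℕ × ℕ).2 : ℝ) + 1) + (((p : ℕ × ℕ).2 : ℝ) + 1) ^ 2)) : ℝ) : ℂ) ^ (-s) =
      (∑ k : Fin 3, ((![Real.sqrt 3 * ℓ ^ 2 / (16 * π), -(3 * ℓ / (8 * π ^ (1 / 2 : ℝ))), 1 / 3] : Fin 3 → ℝ) k : ℂ) /
            (s + ((![(-1 : ℝ), -(1 / 2 : ℝ), 0] : Fin 3 → ℝ) k : ℝ)) -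
          ({p : ℕ × ℕ | (4 * π / (3 * ℓ)) ^ 2 * (((p.1 : ℝ) + 1) ^ 2 + ((p.1 : ℝ) + 1) * ((p.2 : ℝ) + 1) + ((p.2 : ℝ) + 1) ^ 2) = 0}.ncard : ℂ) / s +
        mellin (fun t : ℝ ↦ ((∑' p : {p : ℕ × ℕ | (4 * π / (3 * ℓ)) ^ 2 * (((p.1 : ℝ) + 1) ^ 2 + ((p.1 : ℝ) + 1) * ((p.2 : ℝ) + 1) + ((p.2 : ℝ) + 1) ^ 2) ≠ 0},
            Real.exp (-(t * ((4 * π / (3 * ℓ)) ^ 2 * ((((p : ℕ × ℕ).1 : ℝ) + 1) ^ 2 + (((p : ℕ × ℕ).1 : ℝ) + 1) * (((p : ℕ × ℕ).2 : ℝ) + 1) + (((p : ℕ × ℕ).2 : ℝ) + 1) ^ 2)))) : ℝ) : ℂ) -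
          (Ioc 0 1).indicator (fun t : ℝ ↦ ((∑ k : Fin 3, (![Real.sqrt 3 * ℓ ^ 2 / (16 * π), -(3 * ℓ / (8 * π ^ (1 / 2 : ℝ))), 1 / 3] : Fin 3 → ℝ) k *
              t ^ ((![(-1 : ℝ), -(1 / 2 : ℝ), 0] : Fin 3 → ℝ) k) : ℝ) : ℂ) -
            ({p : ℕ × ℕ | (4 * π / (3 * ℓ)) ^ 2 * (((p.1 : ℝ) + 1) ^ 2 + ((p.1 : ℝ) + 1) * ((p.2 : ℝ) + 1) + ((p.2 : ℝ) + 1) ^ 2) = 0}.ncard : ℂ)) t) s) := by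
  have h := Gamma_mul_tsum_cpow_neg_eq_of_expansion (μ := fun p : ℕ × ℕ ↦ (4 * π / (3 * ℓ)) ^ 2 * (((p.1 : ℝ) + 1) ^ 2 + ((p.1 : ℝ) + 1) * ((p.2 : ℝ) + 1) + ((p.2 : ℝ) + 1) ^ 2))
    (a := ![Real.sqrt 3 * ℓ ^ 2 / (16 * π), -(3 * ℓ / (8 * π ^ (1 / 2 : ℝ))), 1 / 3]) (α := ![(-1 : ℝ), -(1 / 2 : ℝ), 0])
    (β := 1) (σ := 1) (fun p ↦ by positivity) (tendsto_equilateralTriangle_cofinite_atTop hℓ)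
    (fun t ht ↦ summable_exp_neg_mul_equilateralTriangle hℓ ht) (isBigO_equilateralTriangle_heatTrace_expansion hℓ 1)
    (by norm_num) (by norm_num) (fun k ↦ by fin_cases k <;> norm_num) hs
  exact h

/-- **`ζ_T(0) = 1/3` FOR THE EQUILATERAL TRIANGLE: THE THREE CORNERS `π/3` ARE THE VALUE OF THE CONTINUED ZETA FUNCTION AT
`0`** (no zero modes). [cite: Gilkey1995, §1.10 Lemma 1.10.1 ("`ζ` is regular at `s = 0` and its value is given by a local
formula"); McKeanSinger1967, eq. (4a)] -/
theorem tendsto_equilateralTriangleZeta_continuation_nhdsNE_zero (hℓ : 0 < ℓ) :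
    Tendsto (fun s : ℂ ↦ (Complex.Gamma s)⁻¹ *
        (∑ k : Fin 3, ((![Real.sqrt 3 * ℓ ^ 2 / (16 * π), -(3 * ℓ / (8 * π ^ (1 / 2 : ℝ))), 1 / 3] : Fin 3 → ℝ) k : ℂ) /
            (s + ((![(-1 : ℝ), -(1 / 2 : ℝ), 0] : Fin 3 → ℝ) k : ℝ)) -
          ({p : ℕ × ℕ | (4 * π / (3 * ℓ)) ^ 2 * (((p.1 : ℝ) + 1) ^ 2 + ((p.1 : ℝ) + 1) * ((p.2 : ℝ) + 1) + ((p.2 : ℝ) + 1) ^ 2) = 0}.ncard : ℂ) / s +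
        mellin (fun t : ℝ ↦ ((∑' p : {p : ℕ × ℕ | (4 * π / (3 * ℓ)) ^ 2 * (((p.1 : ℝ) + 1) ^ 2 + ((p.1 : ℝ) + 1) * ((p.2 : ℝ) + 1) + ((p.2 : ℝ) + 1) ^ 2) ≠ 0},
            Real.exp (-(t * ((4 * π / (3 * ℓ)) ^ 2 * ((((p : ℕ × ℕ).1 : ℝ) + 1) ^ 2 + (((p : ℕ × ℕ).1 : ℝ) + 1) * (((p : ℕ × ℕ).2 : ℝ) + 1) + (((p : ℕ × ℕ).2 : ℝ) + 1) ^ 2)))) : ℝ) : ℂ) -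
          (Ioc 0 1).indicator (fun t : ℝ ↦ ((∑ k : Fin 3, (![Real.sqrt 3 * ℓ ^ 2 / (16 * π), -(3 * ℓ / (8 * π ^ (1 / 2 : ℝ))), 1 / 3] : Fin 3 → ℝ) k *
              t ^ ((![(-1 : ℝ), -(1 / 2 : ℝ), 0] : Fin 3 → ℝ) k) : ℝ) : ℂ) -
            ({p : ℕ × ℕ | (4 * π / (3 * ℓ)) ^ 2 * (((p.1 : ℝ) + 1) ^ 2 + ((p.1 : ℝ) + 1) * ((p.2 : ℝ) + 1) + ((p.2 : ℝ) + 1) ^ 2) = 0}.ncard : ℂ)) t) s))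
      (𝓝[≠] 0) (𝓝 (1 / 3)) := by
  have h := tendsto_continuation_nhdsNE_zero (μ := fun p : ℕ × ℕ ↦ (4 * π / (3 * ℓ)) ^ 2 * (((p.1 : ℝ) + 1) ^ 2 + ((p.1 : ℝ) + 1) * ((p.2 : ℝ) + 1) + ((p.2 : ℝ) + 1) ^ 2))
    (a := ![Real.sqrt 3 * ℓ ^ 2 / (16 * π), -(3 * ℓ / (8 * π ^ (1 / 2 : ℝ))), 1 / 3]) (α := ![(-1 : ℝ), -(1 / 2 : ℝ), 0])
    (β := 1) (fun p ↦ by positivity) (tendsto_equilateralTriangle_cofinite_atTop hℓ)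
    (fun t ht ↦ summable_exp_neg_mul_equilateralTriangle hℓ ht) (isBigO_equilateralTriangle_heatTrace_expansion hℓ 1)
    one_pos
  have e : ((∑ k : Fin 3, if (![(-1 : ℝ), -(1 / 2 : ℝ), 0] : Fin 3 → ℝ) k = 0 then
      ((![Real.sqrt 3 * ℓ ^ 2 / (16 * π), -(3 * ℓ / (8 * π ^ (1 / 2 : ℝ))), 1 / 3] : Fin 3 → ℝ) k : ℂ) else 0) -
      ({p : ℕ × ℕ | (4 * π / (3 * ℓ)) ^ 2 * (((p.1 : ℝ) + 1) ^ 2 + ((p.1 : ℝ) + 1) * ((p.2 : ℝ) + 1) + ((p.2 : ℝ) + 1) ^ 2) = 0}.ncard : ℂ)) = 1 / 3 := by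
    rw [ncard_setOf_equilateralTriangle_eq_zero hℓ, Fin.sum_univ_three]
    simp only [Matrix.cons_val_zero, Matrix.cons_val_one, Matrix.cons_val,
      show ¬((-1 : ℝ) = 0) by norm_num, show ¬(-(1 / 2 : ℝ) = 0) by norm_num, if_false, if_true, zero_add,
      Nat.cast_zero, sub_zero]
    push_cast
    ring
  rw [e] at h
  exact h

/-- **The continued `ζ_T` is ANALYTIC at `s = 0` with value `1/3`.** [cite: Gilkey1995, §1.10 Lemma 1.10.1] -/
theorem exists_analyticAt_equilateralTriangleZeta_continuation_zero (hℓ : 0 < ℓ) :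
    ∃ Z : ℂ → ℂ, AnalyticAt ℂ Z 0 ∧ Z 0 = 1 / 3 ∧
      ∀ᶠ s in 𝓝[≠] (0 : ℂ), Z s = (Complex.Gamma s)⁻¹ *
        (∑ k : Fin 3, ((![Real.sqrt 3 * ℓ ^ 2 / (16 * π), -(3 * ℓ / (8 * π ^ (1 / 2 : ℝ))), 1 / 3] : Fin 3 → ℝ) k : ℂ) /
            (s + ((![(-1 : ℝ), -(1 / 2 : ℝ), 0] : Fin 3 → ℝ) k : ℝ)) -
          ({p : ℕ × ℕ | (4 * π / (3 * ℓ)) ^ 2 * (((p.1 : ℝ) + 1) ^ 2 + ((p.1 : ℝ) + 1) * ((p.2 : ℝ) + 1) + ((p.2 : ℝ) + 1) ^ 2) = 0}.ncard : ℂ) / s +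
        mellin (fun t : ℝ ↦ ((∑' p : {p : ℕ × ℕ | (4 * π / (3 * ℓ)) ^ 2 * (((p.1 : ℝ) + 1) ^ 2 + ((p.1 : ℝ) + 1) * ((p.2 : ℝ) + 1) + ((p.2 : ℝ) + 1) ^ 2) ≠ 0},
            Real.exp (-(t * ((4 * π / (3 * ℓ)) ^ 2 * ((((p : ℕ × ℕ).1 : ℝ) + 1) ^ 2 + (((p : ℕ × ℕ).1 : ℝ) + 1) * (((p : ℕ × ℕ).2 : ℝ) + 1) + (((p : ℕ × ℕ).2 : ℝ) + 1) ^ 2)))) : ℝ) : ℂ) -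
          (Ioc 0 1).indicator (fun t : ℝ ↦ ((∑ k : Fin 3, (![Real.sqrt 3 * ℓ ^ 2 / (16 * π), -(3 * ℓ / (8 * π ^ (1 / 2 : ℝ))), 1 / 3] : Fin 3 → ℝ) k *
              t ^ ((![(-1 : ℝ), -(1 / 2 : ℝ), 0] : Fin 3 → ℝ) k) : ℝ) : ℂ) -
            ({p : ℕ × ℕ | (4 * π / (3 * ℓ)) ^ 2 * (((p.1 : ℝ) + 1) ^ 2 + ((p.1 : ℝ) + 1) * ((p.2 : ℝ) + 1) + ((p.2 : ℝ) + 1) ^ 2) = 0}.ncard : ℂ)) t) s) := by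
  obtain ⟨Z, hZ, hZ0, hZeq⟩ := exists_analyticAt_continuation_zero (μ := fun p : ℕ × ℕ ↦ (4 * π / (3 * ℓ)) ^ 2 * (((p.1 : ℝ) + 1) ^ 2 + ((p.1 : ℝ) + 1) * ((p.2 : ℝ) + 1) + ((p.2 : ℝ) + 1) ^ 2))
    (a := ![Real.sqrt 3 * ℓ ^ 2 / (16 * π), -(3 * ℓ / (8 * π ^ (1 / 2 : ℝ))), 1 / 3]) (α := ![(-1 : ℝ), -(1 / 2 : ℝ), 0])
    (β := 1) (fun p ↦ by positivity) (tendsto_equilateralTriangle_cofinite_atTop hℓ)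
    (fun t ht ↦ summable_exp_neg_mul_equilateralTriangle hℓ ht) (isBigO_equilateralTriangle_heatTrace_expansion hℓ 1)
    one_pos
  refine ⟨Z, hZ, ?_, hZeq⟩
  rw [hZ0, ncard_setOf_equilateralTriangle_eq_zero hℓ, Fin.sum_univ_three]
  simp only [Matrix.cons_val_zero, Matrix.cons_val_one, Matrix.cons_val,
    show ¬((-1 : ℝ) = 0) by norm_num, show ¬(-(1 / 2 : ℝ) = 0) by norm_num, if_false, if_true, zero_add,
    Nat.cast_zero, sub_zero]
  push_cast
  ring

/-- **Residue `(√3/4)ℓ²/(4π) = |T_ℓ|/(4π)` of `ζ_T` at `s = 1`.** [cite: Gilkey1995, §1.10 Lemma 1.10.1] -/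
theorem tendsto_sub_one_mul_equilateralTriangleZeta_continuation (hℓ : 0 < ℓ) :
    Tendsto (fun s : ℂ ↦ (s - (1 : ℝ)) * ((Complex.Gamma s)⁻¹ *
        (∑ k : Fin 3, ((![Real.sqrt 3 * ℓ ^ 2 / (16 * π), -(3 * ℓ / (8 * π ^ (1 / 2 : ℝ))), 1 / 3] : Fin 3 → ℝ) k : ℂ) /
            (s + ((![(-1 : ℝ), -(1 / 2 : ℝ), 0] : Fin 3 → ℝ) k : ℝ)) -
          ({p : ℕ × ℕ | (4 * π / (3 * ℓ)) ^ 2 * (((p.1 : ℝ) + 1) ^ 2 + ((p.1 : ℝ) + 1) * ((p.2 : ℝ) + 1) + ((p.2 : ℝ) + 1) ^ 2) = 0}.ncard : ℂ) / s +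
        mellin (fun t : ℝ ↦ ((∑' p : {p : ℕ × ℕ | (4 * π / (3 * ℓ)) ^ 2 * (((p.1 : ℝ) + 1) ^ 2 + ((p.1 : ℝ) + 1) * ((p.2 : ℝ) + 1) + ((p.2 : ℝ) + 1) ^ 2) ≠ 0},
            Real.exp (-(t * ((4 * π / (3 * ℓ)) ^ 2 * ((((p : ℕ × ℕ).1 : ℝ) + 1) ^ 2 + (((p : ℕ × ℕ).1 : ℝ) + 1) * (((p : ℕ × ℕ).2 : ℝ) + 1) + (((p : ℕ × ℕ).2 : ℝ) + 1) ^ 2)))) : ℝ) : ℂ) -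
          (Ioc 0 1).indicator (fun t : ℝ ↦ ((∑ k : Fin 3, (![Real.sqrt 3 * ℓ ^ 2 / (16 * π), -(3 * ℓ / (8 * π ^ (1 / 2 : ℝ))), 1 / 3] : Fin 3 → ℝ) k *
              t ^ ((![(-1 : ℝ), -(1 / 2 : ℝ), 0] : Fin 3 → ℝ) k) : ℝ) : ℂ) -
            ({p : ℕ × ℕ | (4 * π / (3 * ℓ)) ^ 2 * (((p.1 : ℝ) + 1) ^ 2 + ((p.1 : ℝ) + 1) * ((p.2 : ℝ) + 1) + ((p.2 : ℝ) + 1) ^ 2) = 0}.ncard : ℂ)) t) s)))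
      (𝓝[≠] ((1 : ℝ) : ℂ)) (𝓝 ((Real.sqrt 3 * ℓ ^ 2 / (16 * π) : ℝ) : ℂ)) := by
  have h := tendsto_sub_mul_continuation_nhdsNE (μ := fun p : ℕ × ℕ ↦ (4 * π / (3 * ℓ)) ^ 2 * (((p.1 : ℝ) + 1) ^ 2 + ((p.1 : ℝ) + 1) * ((p.2 : ℝ) + 1) + ((p.2 : ℝ) + 1) ^ 2))
    (a := ![Real.sqrt 3 * ℓ ^ 2 / (16 * π), -(3 * ℓ / (8 * π ^ (1 / 2 : ℝ))), 1 / 3]) (α := ![(-1 : ℝ), -(1 / 2 : ℝ), 0])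
    (β := 1) (fun p ↦ by positivity) (tendsto_equilateralTriangle_cofinite_atTop hℓ)
    (fun t ht ↦ summable_exp_neg_mul_equilateralTriangle hℓ ht) (isBigO_equilateralTriangle_heatTrace_expansion hℓ 1)
    (s₀ := 1) (by norm_num)
  have e : (Complex.Gamma ((1 : ℝ) : ℂ))⁻¹ *
      ((∑ k : Fin 3, if (![(-1 : ℝ), -(1 / 2 : ℝ), 0] : Fin 3 → ℝ) k = -(1 : ℝ) then
        ((![Real.sqrt 3 * ℓ ^ 2 / (16 * π), -(3 * ℓ / (8 * π ^ (1 / 2 : ℝ))), 1 / 3] : Fin 3 → ℝ) k : ℂ) else 0) -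
        if (1 : ℝ) = 0 then ({p : ℕ × ℕ | (4 * π / (3 * ℓ)) ^ 2 * (((p.1 : ℝ) + 1) ^ 2 + ((p.1 : ℝ) + 1) * ((p.2 : ℝ) + 1) + ((p.2 : ℝ) + 1) ^ 2) = 0}.ncard : ℂ) else 0) =
      ((Real.sqrt 3 * ℓ ^ 2 / (16 * π) : ℝ) : ℂ) := by
    rw [Fin.sum_univ_three]
    simp only [Matrix.cons_val_zero, Matrix.cons_val_one, Matrix.cons_val, if_true,
      show ¬(-(1 / 2 : ℝ) = -1) by norm_num, show ¬((0 : ℝ) = -1) by norm_num, if_false, add_zero, one_ne_zero,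
      sub_zero, Complex.ofReal_one, Complex.Gamma_one, inv_one, one_mul]
  rw [e] at h
  exact h

end Triangle

/-! ### §3 One can hear that a triangular drum is equilateral: the corner term `1/3` versus `¼` (rectangles) and `3/8`
(isosceles right triangles) -/

section HearTheShape

variable {ℓ a p q : ℝ}

/-- **AN EQUILATERAL TRIANGLE IS NEVER DIRICHLET-ISOSPECTRAL TO A RECTANGLE** (`1/3 ≠ ¼`: the corner coefficient is a spectral
invariant, `heatCoeff_eq_of_ncard_eq`). [cite: McKeanSinger1967, eq. (4a); Kac1966, §14; Berard1986, Ch. VII nº4–nº6] -/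
theorem not_isospectral_equilateralTriangle_rectangle (hℓ : 0 < ℓ) (hp : 0 < p) (hq : 0 < q) :
    ¬ ∀ x : ℝ, {r : ℕ × ℕ | (4 * π / (3 * ℓ)) ^ 2 * (((r.1 : ℝ) + 1) ^ 2 + ((r.1 : ℝ) + 1) * ((r.2 : ℝ) + 1) + ((r.2 : ℝ) + 1) ^ 2) = x}.ncard =
      {r : ℕ × ℕ | (π / p) ^ 2 * ((r.1 : ℝ) + 1) ^ 2 + (π / q) ^ 2 * ((r.2 : ℝ) + 1) ^ 2 = x}.ncard := by
  intro hN
  have h := heatCoeff_eq_of_ncard_eq (μ := fun r : ℕ × ℕ ↦ (4 * π / (3 * ℓ)) ^ 2 * (((r.1 : ℝ) + 1) ^ 2 + ((r.1 : ℝ) + 1) * ((r.2 : ℝ) + 1) + ((r.2 : ℝ) + 1) ^ 2))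
    (ν := fun r : ℕ × ℕ ↦ (π / p) ^ 2 * ((r.1 : ℝ) + 1) ^ 2 + (π / q) ^ 2 * ((r.2 : ℝ) + 1) ^ 2)
    (α := ![(-1 : ℝ), -(1 / 2 : ℝ), 0]) (β := 1)
    (tendsto_equilateralTriangle_cofinite_atTop hℓ) (tendsto_dirichletRectangle_cofinite_atTop hp hq) hN
    (fun i j hij ↦ by fin_cases i <;> fin_cases j <;> norm_num at hij <;> rfl)
    (fun k ↦ by fin_cases k <;> norm_num)
    (isBigO_equilateralTriangle_heatTrace_expansion hℓ 1) (isBigO_dirichletRectangle_heatTrace_expansion hp hq 1)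
  have h2 := congrFun h 2
  simp only [Matrix.cons_val] at h2
  norm_num at h2

/-- **… NOR TO AN ISOSCELES RIGHT TRIANGLE** (`1/3 ≠ 3/8`, row g39-#6). [cite: McKeanSinger1967, eq. (4a); Kac1966, §14] -/
theorem not_isospectral_equilateralTriangle_isoscelesRightTriangle (hℓ : 0 < ℓ) (ha : 0 < a) :
    ¬ ∀ x : ℝ, {r : ℕ × ℕ | (4 * π / (3 * ℓ)) ^ 2 * (((r.1 : ℝ) + 1) ^ 2 + ((r.1 : ℝ) + 1) * ((r.2 : ℝ) + 1) + ((r.2 : ℝ) + 1) ^ 2) = x}.ncard =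
      {r : ℕ × ℕ | (π / a) ^ 2 * (((r.1 : ℝ) + r.2 + 2) ^ 2 + ((r.2 : ℝ) + 1) ^ 2) = x}.ncard := by
  intro hN
  have h := heatCoeff_eq_of_ncard_eq (μ := fun r : ℕ × ℕ ↦ (4 * π / (3 * ℓ)) ^ 2 * (((r.1 : ℝ) + 1) ^ 2 + ((r.1 : ℝ) + 1) * ((r.2 : ℝ) + 1) + ((r.2 : ℝ) + 1) ^ 2))
    (ν := fun r : ℕ × ℕ ↦ (π / a) ^ 2 * (((r.1 : ℝ) + r.2 + 2) ^ 2 + ((r.2 : ℝ) + 1) ^ 2))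
    (α := ![(-1 : ℝ), -(1 / 2 : ℝ), 0]) (β := 1)
    (tendsto_equilateralTriangle_cofinite_atTop hℓ) (tendsto_isoscelesRightTriangle_cofinite_atTop ha) hN
    (fun i j hij ↦ by fin_cases i <;> fin_cases j <;> norm_num at hij <;> rfl)
    (fun k ↦ by fin_cases k <;> norm_num)
    (isBigO_equilateralTriangle_heatTrace_expansion hℓ 1) (isBigO_isoscelesRightTriangle_heatTrace_expansion ha 1)
  have h2 := congrFun h 2
  simp only [Matrix.cons_val] at h2
  norm_num at h2

/-- **One can hear the side of an equilateral triangular drum**: isospectral `T_ℓ`, `T_{ℓ'}` have `ℓ = ℓ'` (the area is audible).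
[cite: McKeanSinger1967, p. 43, eq. (4a)] -/
theorem eq_of_isospectral_equilateralTriangles {ℓ' : ℝ} (hℓ : 0 < ℓ) (hℓ' : 0 < ℓ')
    (hN : ∀ x : ℝ, {r : ℕ × ℕ | (4 * π / (3 * ℓ)) ^ 2 * (((r.1 : ℝ) + 1) ^ 2 + ((r.1 : ℝ) + 1) * ((r.2 : ℝ) + 1) + ((r.2 : ℝ) + 1) ^ 2) = x}.ncard =
      {r : ℕ × ℕ | (4 * π / (3 * ℓ')) ^ 2 * (((r.1 : ℝ) + 1) ^ 2 + ((r.1 : ℝ) + 1) * ((r.2 : ℝ) + 1) + ((r.2 : ℝ) + 1) ^ 2) = x}.ncard) :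
    ℓ = ℓ' := by
  have h := heatCoeff_eq_of_ncard_eq (μ := fun r : ℕ × ℕ ↦ (4 * π / (3 * ℓ)) ^ 2 * (((r.1 : ℝ) + 1) ^ 2 + ((r.1 : ℝ) + 1) * ((r.2 : ℝ) + 1) + ((r.2 : ℝ) + 1) ^ 2))
    (ν := fun r : ℕ × ℕ ↦ (4 * π / (3 * ℓ')) ^ 2 * (((r.1 : ℝ) + 1) ^ 2 + ((r.1 : ℝ) + 1) * ((r.2 : ℝ) + 1) + ((r.2 : ℝ) + 1) ^ 2))
    (α := ![(-1 : ℝ), -(1 / 2 : ℝ), 0]) (β := 1)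
    (tendsto_equilateralTriangle_cofinite_atTop hℓ) (tendsto_equilateralTriangle_cofinite_atTop hℓ') hN
    (fun i j hij ↦ by fin_cases i <;> fin_cases j <;> norm_num at hij <;> rfl)
    (fun k ↦ by fin_cases k <;> norm_num)
    (isBigO_equilateralTriangle_heatTrace_expansion hℓ 1) (isBigO_equilateralTriangle_heatTrace_expansion hℓ' 1)
  have hπ : 0 < π := Real.pi_pos
  have hπ2 : 0 < π ^ (1 / 2 : ℝ) := Real.rpow_pos_of_pos hπ _
  have h1 := congrFun h 1
  simp only [Matrix.cons_val_one, Matrix.cons_val_zero] at h1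
  field_simp at h1
  linarith

end HearTheShape

end Literature.Analysis.InnerProduct
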